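import Literature.NumberTheory.ModularForms.BinaryQuadGaussSumValues
import HarnessLib

/-!
# Gauss sums of binary quadratic forms, IV: the twisted sums — the nondegenerate evaluation
# `G(a, c; f, w) = e(āD̄f̃(w)/c)·(D/c)·c` and the modulus `|G(a, c; f, w)| ∈ {0, c√s}` in general

Topic `NumberTheory/ModularForms` (namespace `Literature.NumberTheory.ModularForms`), continuing
`BinaryQuadGaussSum{,Basic,Values}.lean`. Everything here is PROVED (theorems only; no definition,
no named fact). With `f = (A, B, C)`, `D = B² − 4AC`, `f̃ = (C, −B, A)` the adjoint form, and an
ODD modulus `c`: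

* `binQuadGaussSum_eq_of_coprime` — **complete evaluation when `(c, 2aAD) = 1`**:
  `G(a, c; f, w) = e(ā·D̄·(Cw₁² − Bw₁w₂ + Aw₂²)/c) · (D/c) · c` (completing the square, file II,
  and the unramified value, file III); `binQuadGaussSum_eq_of_coprime_of_isPrimitive` drops the
  condition on `A` for primitive `f`.
* `norm_binQuadGaussSum_eq` — **the modulus in general**: if `c = s·c₁`, `D = s·D₁`,
  `(D₁, c₁) = 1` (so `s = (c, D)` for squarefree `D`), `A` and `a` units mod `c`, then
  `|G(a, c; f, w)| = c·√s` if `s ∣ (w₂ − B(2A)⁻¹w₁)` (i.e. `2Aw₂ ≡ Bw₁ (mod s)`), and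
  `G(a, c; f, w) = 0` otherwise — diagonalisation (file II), `|G(t, k; c)| = √c` for a unit `t`
  (file III) for the first factor, and the reduction of the modulus `G(s·t', k; s·c₁) =
  s·[s ∣ k]·G(t', k/s; c₁)` (file II) for the second, whose quadratic coefficient `−a(4A)⁻¹D` is
  divisible by `s` exactly.

These are the size statements a summation formula built on the two-dimensional Poisson formula
needs (`|ψ_m(a)| ≤ A τ(m)/c`-type bounds for the dual coefficients, Conrey–Iwaniec (4.4), (4.7);
the vanishing `2Aw₂ ≢ Bw₁ (mod s) ⇒ G = 0` is what thins the dual lattice at a cusp with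
`(c, q) = s > 1`, loc. cit. (3.17)–(3.18)).

## References

* A. N. Andrianov, V. G. Zhuravlev, *Modular Forms and Hecke Operators*, Transl. Math. Monogr.
  145, AMS (1995/2015), Ch. 1 §4.3 (4.10), (4.13)–(4.14); §4.4 Proposition 4.9; §4.5 Lemmas
  4.13–4.14, (4.51) [AndrianovZhuravlev2015].
* B. Conrey, H. Iwaniec, Acta Arith. 103 (2002) 259–312, §3 (3.14)–(3.18), §4 (4.3)–(4.7)
  [ConreyIwaniec2002].
-/

noncomputable section

open Complex Finset

namespace Literature.NumberTheory.ModularForms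

open Literature.NumberTheory.EllipticCurves.ModularForms
open Literature.NumberTheory.QuadraticFields.Quadratic (BinQF)
open Literature.NumberTheory.LFunctions (norm_stdAddChar)

open scoped NumberTheorySymbols

variable {c : ℕ} [NeZero c]

omit [NeZero c] in
/-- `2` is a unit modulo an odd `c` (plumbing). [folklore] -/
private theorem isUnit_two_zmod' (hc : Odd c) : IsUnit (2 : ZMod c) := by
  have : ((2 : ℕ) : ZMod c) = 2 := by norm_cast
  rw [← this, ZMod.isUnit_iff_coprime]
  exact Nat.coprime_two_left.mpr hc

omit [NeZero c] in
/-- An integer prime to `c` is a unit mod `c` (plumbing). [folklore] -/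
private theorem isUnit_intCast_of_gcd_eq_one' {a : ℤ} (h : a.gcd c = 1) :
    IsUnit (a : ZMod c) := by
  obtain ⟨u, v, huv⟩ := Int.isCoprime_iff_gcd_eq_one.mpr h
  refine IsUnit.of_mul_eq_one (u : ZMod c) ?_
  have := congrArg (fun x : ℤ ↦ (x : ZMod c)) huv
  simp only [Int.cast_add, Int.cast_mul, Int.cast_natCast, ZMod.natCast_self, mul_zero, add_zero,
    Int.cast_one] at this
  rw [mul_comm]
  exact this

/-! ### The nondegenerate case: complete evaluation -/

/-- **Complete evaluation of the twisted binary Gauss sum for `(c, 2aAD) = 1`**: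
`G(a, c; f, w) = e(ā·D̄·(Cw₁² − Bw₁w₂ + Aw₂²)/c) · (D/c) · c` (`aā ≡ DD̄ ≡ 1 (mod c)`,
`(D/c)` the Jacobi symbol): completing the square (`binQuadGaussSum_eq_stdAddChar_mul`) and the
unramified value `G(a, c; f, 0) = (D/c)c` (`binQuadGaussSum_zero_zero_eq_jacobiSym_mul`).
[cite: AndrianovZhuravlev2015, Ch. 1 §4.3–4.4, (4.13)–(4.14) and Proposition 4.9 with (4.33)] -/
theorem binQuadGaussSum_eq_of_coprime (hc : Odd c) (f : BinQF) {a : ℤ} (ha : a.gcd c = 1)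
    (hA : f.a.gcd c = 1) (hD : f.disc.gcd c = 1) (w₁ w₂ : ZMod c) :
    binQuadGaussSum c f a w₁ w₂ =
      (ZMod.stdAddChar ((a : ZMod c)⁻¹ * ((f.disc : ℤ) : ZMod c)⁻¹ *
          ((f.c : ZMod c) * w₁ ^ 2 - (f.b : ZMod c) * w₁ * w₂ + (f.a : ZMod c) * w₂ ^ 2)) : ℂ) *
        (jacobiSym f.disc c * c) := by
  rw [binQuadGaussSum_eq_stdAddChar_mul f (isUnit_intCast_of_gcd_eq_one' ha)
      (isUnit_intCast_of_gcd_eq_one' hD) w₁ w₂,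
    binQuadGaussSum_zero_zero_eq_jacobiSym_mul hc f ha hA hD]

/-- The same for a PRIMITIVE form `f` and `(c, 2aD) = 1`, without a condition on the leading
coefficient. [cite: AndrianovZhuravlev2015, Ch. 1 §4.3–4.4, (4.13)–(4.14) and Proposition 4.9 with (4.33)] -/
theorem binQuadGaussSum_eq_of_coprime_of_isPrimitive (hc : Odd c) {f : BinQF}
    (hf : f.IsPrimitive) {a : ℤ} (ha : a.gcd c = 1) (hD : f.disc.gcd c = 1) (w₁ w₂ : ZMod c) :
    binQuadGaussSum c f a w₁ w₂ =
      (ZMod.stdAddChar ((a : ZMod c)⁻¹ * ((f.disc : ℤ) : ZMod c)⁻¹ *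
          ((f.c : ZMod c) * w₁ ^ 2 - (f.b : ZMod c) * w₁ * w₂ + (f.a : ZMod c) * w₂ ^ 2)) : ℂ) *
        (jacobiSym f.disc c * c) := by
  rw [binQuadGaussSum_eq_stdAddChar_mul f (isUnit_intCast_of_gcd_eq_one' ha)
      (isUnit_intCast_of_gcd_eq_one' hD) w₁ w₂,
    binQuadGaussSum_zero_zero_eq_jacobiSym_mul_of_isPrimitive hc hf ha hD]

/-- In particular `|G(a, c; f, w)| = c` for primitive `f` and `(c, 2aD) = 1`, every twist `w`.
[cite: AndrianovZhuravlev2015, Ch. 1 §4.4 Proposition 4.9 with §4.5 Lemma 4.14] -/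
theorem norm_binQuadGaussSum_of_coprime_of_isPrimitive (hc : Odd c) {f : BinQF}
    (hf : f.IsPrimitive) {a : ℤ} (ha : a.gcd c = 1) (hD : f.disc.gcd c = 1) (w₁ w₂ : ZMod c) :
    ‖binQuadGaussSum c f a w₁ w₂‖ = c := by
  rw [binQuadGaussSum_eq_of_coprime_of_isPrimitive hc hf ha hD, norm_mul, norm_stdAddChar,
    one_mul, norm_mul, Complex.norm_natCast]
  rcases jacobiSym.eq_one_or_neg_one hD with h | h <;> rw [h] <;> simp

/-! ### The general case: `|G(a, c; f, w)| ∈ {0, c√s}` -/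

/-- **The modulus of the twisted binary Gauss sum.** Let `c = s·c₁` be odd and let the
discriminant factor as `D = s·D₁` with `(D₁, c₁) = 1` (so `s = (c, D)` for squarefree `D`);
let `A` and `a` be units mod `c`. Then, with `k₂ = w₂ − B(2A)⁻¹w₁`,
`|G(a, c; f, w)| = c·√s` if `s ∣ k₂` (a congruence `2Aw₂ ≡ Bw₁ (mod s)`), and `G(a, c; f, w) = 0`
otherwise: after diagonalisation the first factor `G(a(4A)⁻¹, w₁(2A)⁻¹; c)` has modulus `√c`
(unit quadratic coefficient), and the second, `G(−a(4A)⁻¹D, k₂; c)` with `−a(4A)⁻¹D = s·t'`,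
`(t', c₁) = 1`, is `s·[s ∣ k₂]·G(t', k₂/s; c₁)` of modulus `s√c₁` or `0`.
[cite: AndrianovZhuravlev2015, Ch. 1 §4.4–4.5, proof of Proposition 4.9 and Lemmas 4.13–4.14 (with (4.51))] -/
theorem norm_binQuadGaussSum_eq (hc : Odd c) (f : BinQF) (hA : IsUnit (f.a : ZMod c))
    {s c₁ : ℕ} [NeZero s] [NeZero c₁] (hcs : c = s * c₁) {D₁ : ℤ} (hD : f.disc = s * D₁)
    (hD₁ : D₁.gcd c₁ = 1) {a : ZMod c} (ha : IsUnit a) (w₁ w₂ : ZMod c) :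
    ‖binQuadGaussSum c f a w₁ w₂‖ =
      if s ∣ (w₂ - (f.b : ZMod c) * (2 * (f.a : ZMod c))⁻¹ * w₁).val then (c : ℝ) * Real.sqrt s
      else 0 := by
  -- diagonalise first, then name the pieces
  rw [binQuadGaussSum_eq_quadGaussSum_mul hc f hA a w₁ w₂, norm_mul]
  set α : ZMod c := (f.a : ZMod c) with hα
  set β : ZMod c := (f.b : ZMod c) with hβ
  set k₂ : ZMod c := w₂ - β * (2 * α)⁻¹ * w₁ with hk₂
  set i4 : ZMod c := (4 * α)⁻¹ with hi4
  have hc₁odd : Odd c₁ := (Nat.odd_mul.mp (hcs ▸ hc)).2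
  have h2 : IsUnit (2 : ZMod c) := isUnit_two_zmod' hc
  have h4A : IsUnit (4 * α) := by
    have : (4 : ZMod c) * α = 2 * (2 * α) := by ring
    rw [this]; exact h2.mul (h2.mul hA)
  have e4 : 4 * α * i4 = 1 := ZMod.mul_inv_of_unit _ h4A
  have hu4 : IsUnit i4 := IsUnit.of_mul_eq_one (4 * α) (by rw [mul_comm, e4])
  -- the first factor has modulus `√c`
  rw [norm_quadGaussSum_of_isUnit hc (ha.mul hu4)]
  -- the second factor: quadratic coefficient `-(a i4 D) = s · T` with `T = -(a.val i4.val D₁)`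
  set T : ℤ := -((a.val : ℤ) * (i4.val : ℤ) * D₁) with hT
  have hDc : ((f.disc : ℤ) : ZMod c) = (s : ZMod c) * (D₁ : ZMod c) := by
    rw [hD]; push_cast; ring
  have ht : -(a * i4 * ((f.disc : ℤ) : ZMod c)) = (((s : ℤ) * T : ℤ) : ZMod c) := by
    rw [hT, hDc]; push_cast; rw [ZMod.natCast_zmod_val, ZMod.natCast_zmod_val]; ring
  have hred := quadGaussSum_eq_of_dvd hcs T ((k₂.val : ℕ) : ℤ)
  rw [Int.cast_natCast, ZMod.natCast_zmod_val, ← ht] at hred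
  simp only [Int.natCast_dvd_natCast] at hred
  rw [hred]
  -- `T` is a unit mod `c₁`
  have hTu : IsUnit ((T : ℤ) : ZMod c₁) := by
    have dvd₁ : c₁ ∣ c := ⟨s, by rw [hcs, mul_comm]⟩
    have cop := fun {x : ℤ} {n : ℕ} (h : x.gcd n = 1) ↦ Int.isCoprime_iff_gcd_eq_one.mpr h
    have hav : ((a.val : ℕ) : ℤ).gcd c₁ = 1 := by
      rw [Int.gcd_natCast_natCast]
      have := ZMod.val_coe_unit_coprime ha.unit
      rw [IsUnit.unit_spec] at this
      exact this.coprime_dvd_right dvd₁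
    have hiv : ((i4.val : ℕ) : ℤ).gcd c₁ = 1 := by
      rw [Int.gcd_natCast_natCast]
      have := ZMod.val_coe_unit_coprime hu4.unit
      rw [IsUnit.unit_spec] at this
      exact this.coprime_dvd_right dvd₁
    refine isUnit_intCast_of_gcd_eq_one' (Int.isCoprime_iff_gcd_eq_one.mp ?_)
    rw [hT]
    exact (((cop hav).mul_left (cop hiv)).mul_left (cop hD₁)).neg_left
  by_cases hdiv : s ∣ k₂.val
  · rw [if_pos hdiv, if_pos hdiv, norm_mul, Complex.norm_natCast,
      norm_quadGaussSum_of_isUnit hc₁odd hTu]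
    have hc' : (c : ℝ) = s * c₁ := by rw [hcs, Nat.cast_mul]
    rw [show Real.sqrt c = Real.sqrt s * Real.sqrt c₁ by
          rw [hc', Real.sqrt_mul (Nat.cast_nonneg _)], hc']
    have hr := Real.mul_self_sqrt (Nat.cast_nonneg c₁ : (0 : ℝ) ≤ c₁)
    linear_combination (Real.sqrt s * s) * hr
  · rw [if_neg hdiv, if_neg hdiv, norm_zero, mul_zero]

/-- The divisibility condition of `norm_binQuadGaussSum_eq` as a congruence free of inverses:
`s ∣ (w₂ − B(2A)⁻¹w₁)` iff `2Aw₂ ≡ Bw₁ (mod s)` (`2A` is a unit). [cite: AndrianovZhuravlev2015, Ch. 1 §4.4, proof of Proposition 4.9] -/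
theorem dvd_val_twist_iff (hc : Odd c) (f : BinQF) (hA : IsUnit (f.a : ZMod c)) {s c₁ : ℕ}
    [NeZero s] (hcs : c = s * c₁) (w₁ w₂ : ZMod c) :
    s ∣ (w₂ - (f.b : ZMod c) * (2 * (f.a : ZMod c))⁻¹ * w₁).val ↔
      (ZMod.castHom (show s ∣ c from ⟨c₁, hcs⟩) (ZMod s))
          (2 * (f.a : ZMod c) * w₂ - (f.b : ZMod c) * w₁) = 0 := by
  set α : ZMod c := (f.a : ZMod c) with hα
  set β : ZMod c := (f.b : ZMod c) with hβ
  have hsc : s ∣ c := ⟨c₁, hcs⟩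
  have h2A : IsUnit (2 * α) := (isUnit_two_zmod' hc).mul hA
  have e2 : 2 * α * (2 * α)⁻¹ = 1 := ZMod.mul_inv_of_unit _ h2A
  set φ := ZMod.castHom hsc (ZMod s) with hφ
  have key : 2 * α * w₂ - β * w₁ = 2 * α * (w₂ - β * (2 * α)⁻¹ * w₁) := by
    linear_combination (β * w₁) * e2
  have hval : ∀ x : ZMod c, s ∣ x.val ↔ φ x = 0 := by
    intro x
    rw [hφ, ZMod.castHom_apply, ZMod.cast_eq_val, ZMod.natCast_eq_zero_iff]
  rw [hval, key, map_mul]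
  constructor
  · intro h; rw [h, mul_zero]
  · intro h
    have hu : IsUnit (φ (2 * α)) := h2A.map φ
    exact (hu.mul_right_eq_zero).mp h

end Literature.NumberTheory.ModularForms

end
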